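import Literature.MathematicalPhysics.QuantumLattice.TIClassPhaseCoexistenceExclusion
import Literature.MathematicalPhysics.QuantumLattice.HubbardTTPrimeThermalPhaseCoexistenceCanonicalPeriodic
import HarnessLib

/-!
# Model-free phase-coexistence exclusion for SUPERLATTICE-PERIODIC phases: for ANY finite-range interaction on `ℤ^d`
# and ANY family of conserved charges, one certified strict-convexity defect of `c ↦ e_c(Ψ)` excludes macroscopic
# coexistence of two periodic phases (stripes, Néel / density-wave states) read through their cell-averaged charges

Topic `Literature/MathematicalPhysics/QuantumLattice` (general `d`, any `Ψ : FermionInteraction d`, any charge family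
`C : κ → FermionInteraction d`). Sequel of `TIClassPhaseCoexistenceExclusion` (the TRANSLATION-INVARIANT statement: if
`c < a f₁ + b f₂` is certified along a segment of charge space, no mixture `λω₁ + (1−λ)ω₂` of translation-invariant states of
charges `c₁, c₂` (the endpoints, or any two points outside the defect's sub-segment) is a constrained minimiser — its energy
density is STRICTLY above `e_{λc₁+(1−λ)c₂}(Ψ)`), whose header records the gap «periodic / finite-period states carry ONE
charge vector and are not excluded». `HubbardTTPrimePhaseCoexistenceExclusionPeriodic` (hubbard-box-p3) closed that gap for the
filling of the one-band `t–t'` model; this file closes it ONCE for every model and every charge family, by the state identity of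
`HubbardTTPrimeThermalPhaseCoexistenceCanonicalPeriodic` §1: cell averaging is AFFINE on states
(`cellAverage_mix : (λω₁ + (1−λ)ω₂)‾ = λω̄₁ + (1−λ)ω̄₂`) and sends `q`-periodic states to translation-invariant ones
(`IsPeriodic.isTranslationInvariant_cellAverage`).

THE READING. For a `q`-periodic state `ω` (a stripe, a Néel state, a density wave) the translation-invariant state
`ω̄ = ω.cellAverage q` carries the PER-SITE numbers of `ω`: its charges `e_{C_k}(ω̄)` are the cell-averaged charge densities of
`ω` and its mean energy `e_Ψ(ω̄)` is the energy per site of `ω` (`meanEnergy_cellAverage`). A macroscopically phase-separated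
state `λω₁ + (1−λ)ω₂` of two `q`-periodic phases is `q`-periodic with cell average `λω̄₁ + (1−λ)ω̄₂`; so its energy per site is
the mean energy of a translation-invariant mixture of states of charges `c̄₁, c̄₂` — and the translation-invariant theorems apply
verbatim: under a certified defect the phase-separated state lies STRICTLY ABOVE the constrained variational energy `e_{λc̄₁+(1−λ)c̄₂}`
at its own per-site charges, i.e. some translation-invariant state with the same charges does strictly better.

PROVED (every `d`, `Ψ`, `C`, `R`; `ω₁, ω₂` `q`-periodic with cell-average charges `c̄₁, c̄₂`; `0 < λ < 1`):
* `IsPeriodic.cellAverage_mem_tiClassWith` (the cell average lies in the constraint class of its own charges);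
* `IsPeriodic.meanEnergy_cellAverage_mix` (energy per site of the phase-separated state = `λ e_Ψ(ω̄₁) + (1−λ) e_Ψ(ω̄₂)`);
* the exclusion readings `IsPeriodic.infMeanEnergyOn_tiClassWith_lt_meanEnergy_cellAverage_mix_of_strict_at` (one strict defect
  at an interior point), `…_of_cap_lt_floors` (certified cap/floors), `…_of_strict_at_of_mem_segment` (SUPER-SEGMENT form: the
  defect may sit on a sub-segment), and the energy gap `IsPeriodic.infMeanEnergyOn_tiClassWith_add_margin_le_meanEnergy_cellAverage_mix`;
* two period lattices: both phases are periodic under the product lattice (`IsPeriodic.isPeriodic_prodPeriod_left/right` of the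
  `t–t'` file), so every statement applies with the charges read over the product cell (`…_of_cap_lt_floors₂`).

HONEST SCOPE: statements about infinite-volume states and two-component convex decompositions into superlattice-periodic states
with a common period lattice (aperiodic components are not covered); the identification of `e_c(Ψ)` with torus sector energies is in
the tree for the filling of the `t–t'` model only; nothing here is a certificate or a number. Everything is PROVED; no definition,
no named fact, no `sorry`.

## Mathlib / tree search

REUSED: `tiClassWith`, `mem_tiClassWith_self` (`TIGroundEnergyDensityConservedDensities`); every exclusion form of
`TIClassPhaseCoexistenceExclusion`; `cellAverage_mix` (`HubbardTTPrimeThermalPhaseCoexistenceCanonicalPeriodic` §1);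
`IsPeriodic.isTranslationInvariant_cellAverage` (`PeriodicStatesCellAverage`); `IsPeriodic.isPeriodic_prodPeriod_left/right`
(`HubbardTTPrimePhaseCoexistenceExclusionPeriodic`); `meanEnergy_mix` (`InfVolFermionState`).
`lean search 'tiClassWith.*Periodic|cellAverage.*tiClassWith'` (2026-08-28): no hits.
presearch: as recorded in `HubbardTTPrimeThermalPhaseCoexistenceCanonicalPeriodic` (corpus hybrid + galaxy: none; Israel 1979
Thm. I.2.4 is the translation-invariant statement).

## References

* R. B. Israel, *Convexity in the Theory of Lattice Gases* (1979), Thm. I.2.4. [cite: Israel1979, Thm. I.2.4]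
* D. Ruelle, *Statistical Mechanics: Rigorous Results* (1969), §3.4 (convexity in the densities). [cite: Ruelle1969, §3.4]
* O. Bratteli, D. W. Robinson, *OAQSM 1* (1987), §4.3.1 (averages over a group action). [cite: BratteliRobinsonI1987, §4.3.1]
* V. J. Emery, S. A. Kivelson, H. Q. Lin, Phys. Rev. Lett. 64 (1990) 475–478. [cite: EmeryKivelsonLin1990, pp. 475–476]
-/

noncomputable section

open scoped ComplexOrder BigOperators

namespace Literature.MathematicalPhysics.QuantumLattice

open InfVolFermionState FermionInteraction Set

namespace InfVolFermionState

variable {d : ℕ} {κ : Type*} (C : κ → FermionInteraction d) (Ψ : FermionInteraction d) (R : ℝ) {q : Fin d → ℕ}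
  {ω₁ ω₂ : InfVolFermionState d}

/-! ### §1 The cell average of a periodic phase is a translation-invariant state of the class of its own per-site charges -/

/-- **The cell average lies in the constraint class of its own charges** (it is translation invariant).
[cite: Ruelle1969, §3.4] [cite: BratteliRobinsonI1987, §4.3.1] -/
theorem IsPeriodic.cellAverage_mem_tiClassWith {ω : InfVolFermionState d} (hω : ω.IsPeriodic q) :
    ω.cellAverage q ∈ tiClassWith C R (fun k => (ω.cellAverage q).meanEnergy (C k) R) :=
  mem_tiClassWith_self C R hω.isTranslationInvariant_cellAverage

omit C in
/-- **Energy per site of the phase-separated state** (two states, any common superlattice): the mean energy of the cell average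
of `λω₁ + (1−λ)ω₂` is `λ e_Ψ(ω̄₁) + (1−λ) e_Ψ(ω̄₂)`. [cite: BratteliRobinsonI1987, §4.3.1] -/
theorem meanEnergy_cellAverage_mix (s : ℝ) (hs₀ : 0 ≤ s) (hs₁ : s ≤ 1) (ω₁ ω₂ : InfVolFermionState d) :
    ((InfVolFermionState.mix s hs₀ hs₁ ω₁ ω₂).cellAverage q).meanEnergy Ψ R =
      s * (ω₁.cellAverage q).meanEnergy Ψ R + (1 - s) * (ω₂.cellAverage q).meanEnergy Ψ R := by
  rw [cellAverage_mix, meanEnergy_mix]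

/-! ### §2 The exclusion readings for periodic phases (charges = cell-average charges) -/

/-- **One strict defect excludes coexistence of two PERIODIC phases.** `ω₁, ω₂` `q`-periodic with cell-average charges `c₁, c₂`;
`a, b ≥ 0`, `a + b = 1` with `e_{a c₁ + b c₂} < a e_{c₁} + b e_{c₂}`. Then for every `0 < λ < 1` the energy per site of the
phase-separated state `λω₁ + (1−λ)ω₂` is STRICTLY above the constrained variational energy at its per-site charges:
`e_{λc₁+(1−λ)c₂}(Ψ) < e_Ψ((λω₁ + (1−λ)ω₂)‾)` — a translation-invariant state with the same charges does strictly better.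
[cite: Israel1979, Thm. I.2.4] -/
theorem IsPeriodic.infMeanEnergyOn_tiClassWith_lt_meanEnergy_cellAverage_mix_of_strict_at (h₁ : ω₁.IsPeriodic q)
    (h₂ : ω₂.IsPeriodic q) {c₁ c₂ : κ → ℝ} (hc₁ : ∀ k, (ω₁.cellAverage q).meanEnergy (C k) R = c₁ k)
    (hc₂ : ∀ k, (ω₂.cellAverage q).meanEnergy (C k) R = c₂ k) {a b : ℝ} (ha : 0 ≤ a) (hb : 0 ≤ b) (hab : a + b = 1)
    (hstrict : infMeanEnergyOn (tiClassWith C R (fun k => a * c₁ k + b * c₂ k)) Ψ R <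
      a * infMeanEnergyOn (tiClassWith C R c₁) Ψ R + b * infMeanEnergyOn (tiClassWith C R c₂) Ψ R)
    {lam : ℝ} (hl0 : 0 < lam) (hl1 : lam < 1) :
    infMeanEnergyOn (tiClassWith C R (fun k => lam * c₁ k + (1 - lam) * c₂ k)) Ψ R <
      ((InfVolFermionState.mix lam hl0.le hl1.le ω₁ ω₂).cellAverage q).meanEnergy Ψ R := by
  rw [cellAverage_mix]
  exact infMeanEnergyOn_tiClassWith_lt_meanEnergy_mix_of_strict_at C Ψ R ⟨h₁.isTranslationInvariant_cellAverage, hc₁⟩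
    ⟨h₂.isTranslationInvariant_cellAverage, hc₂⟩ ha hb hab hstrict hl0 hl1

/-- **Certified exclusion from windows on the constrained energies, periodic phases**: a CAP `e_{a c₁ + b c₂} ≤ u` and FLOORS
`f₁ ≤ e_{c₁}`, `f₂ ≤ e_{c₂}` with `u < a f₁ + b f₂` (charges `cᵢ` = cell-average charges of the `q`-periodic `ωᵢ`) put every
phase-separated state `λω₁ + (1−λ)ω₂` strictly above `e` at its per-site charges. [cite: EmeryKivelsonLin1990, pp. 475–476] -/
theorem IsPeriodic.infMeanEnergyOn_tiClassWith_lt_meanEnergy_cellAverage_mix_of_cap_lt_floors (h₁ : ω₁.IsPeriodic q)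
    (h₂ : ω₂.IsPeriodic q) {c₁ c₂ : κ → ℝ} (hc₁ : ∀ k, (ω₁.cellAverage q).meanEnergy (C k) R = c₁ k)
    (hc₂ : ∀ k, (ω₂.cellAverage q).meanEnergy (C k) R = c₂ k) {a b : ℝ} (ha : 0 ≤ a) (hb : 0 ≤ b) (hab : a + b = 1)
    {u f₁ f₂ : ℝ} (hcap : infMeanEnergyOn (tiClassWith C R (fun k => a * c₁ k + b * c₂ k)) Ψ R ≤ u)
    (hf₁ : f₁ ≤ infMeanEnergyOn (tiClassWith C R c₁) Ψ R) (hf₂ : f₂ ≤ infMeanEnergyOn (tiClassWith C R c₂) Ψ R)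
    (hu : u < a * f₁ + b * f₂) {lam : ℝ} (hl0 : 0 < lam) (hl1 : lam < 1) :
    infMeanEnergyOn (tiClassWith C R (fun k => lam * c₁ k + (1 - lam) * c₂ k)) Ψ R <
      ((InfVolFermionState.mix lam hl0.le hl1.le ω₁ ω₂).cellAverage q).meanEnergy Ψ R := by
  rw [cellAverage_mix]
  exact infMeanEnergyOn_tiClassWith_lt_meanEnergy_mix_of_cap_lt_floors C Ψ R ⟨h₁.isTranslationInvariant_cellAverage, hc₁⟩
    ⟨h₂.isTranslationInvariant_cellAverage, hc₂⟩ ha hb hab hcap hf₁ hf₂ hu hl0 hl1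

/-- **Super-segment form, periodic phases**: the certified defect may sit on a SUB-segment (`0 ≤ s₁ < s₂ ≤ 1`, inner points
`(1−sᵢ)c₁ + sᵢc₂`, weights `a, b`) of the segment joining the cell-average charges `c₁, c₂` of the two `q`-periodic phases; every
phase-separated state `λω₁ + (1−λ)ω₂` is still strictly above `e` at its per-site charges. [cite: Israel1979, Thm. I.2.4] -/
theorem IsPeriodic.infMeanEnergyOn_tiClassWith_lt_meanEnergy_cellAverage_mix_of_strict_at_of_mem_segment
    (h₁ : ω₁.IsPeriodic q) (h₂ : ω₂.IsPeriodic q) {c₁ c₂ : κ → ℝ} (hc₁ : ∀ k, (ω₁.cellAverage q).meanEnergy (C k) R = c₁ k)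
    (hc₂ : ∀ k, (ω₂.cellAverage q).meanEnergy (C k) R = c₂ k) {s₁ s₂ : ℝ} (hs₁ : 0 ≤ s₁) (hs : s₁ < s₂) (hs₂ : s₂ ≤ 1)
    {a b : ℝ} (ha : 0 ≤ a) (hb : 0 ≤ b) (hab : a + b = 1)
    (hstrict : infMeanEnergyOn (tiClassWith C R (fun k =>
        a * ((1 - s₁) * c₁ k + s₁ * c₂ k) + b * ((1 - s₂) * c₁ k + s₂ * c₂ k))) Ψ R <
      a * infMeanEnergyOn (tiClassWith C R (fun k => (1 - s₁) * c₁ k + s₁ * c₂ k)) Ψ R +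
        b * infMeanEnergyOn (tiClassWith C R (fun k => (1 - s₂) * c₁ k + s₂ * c₂ k)) Ψ R)
    {lam : ℝ} (hl0 : 0 < lam) (hl1 : lam < 1) :
    infMeanEnergyOn (tiClassWith C R (fun k => lam * c₁ k + (1 - lam) * c₂ k)) Ψ R <
      ((InfVolFermionState.mix lam hl0.le hl1.le ω₁ ω₂).cellAverage q).meanEnergy Ψ R := by
  rw [cellAverage_mix]
  exact infMeanEnergyOn_tiClassWith_lt_meanEnergy_mix_of_strict_at_of_mem_segment C Ψ R
    ⟨h₁.isTranslationInvariant_cellAverage, hc₁⟩ ⟨h₂.isTranslationInvariant_cellAverage, hc₂⟩ hs₁ hs hs₂ ha hb hab hstrict hl0 hl1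

/-- **Energy gap of the phase-separated state of two periodic phases**: with floors `fᵢ ≤ e_{cᵢ}` and a cap
`e_{λc₁+(1−λ)c₂} ≤ u`, the energy per site of `λω₁ + (1−λ)ω₂` is at least `e_{λc₁+(1−λ)c₂} + (λf₁ + (1−λ)f₂ − u)`.
[cite: EmeryKivelsonLin1990, pp. 475–476] -/
theorem IsPeriodic.infMeanEnergyOn_tiClassWith_add_margin_le_meanEnergy_cellAverage_mix (h₁ : ω₁.IsPeriodic q)
    (h₂ : ω₂.IsPeriodic q) {c₁ c₂ : κ → ℝ} (hc₁ : ∀ k, (ω₁.cellAverage q).meanEnergy (C k) R = c₁ k)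
    (hc₂ : ∀ k, (ω₂.cellAverage q).meanEnergy (C k) R = c₂ k) {u f₁ f₂ : ℝ}
    (hf₁ : f₁ ≤ infMeanEnergyOn (tiClassWith C R c₁) Ψ R) (hf₂ : f₂ ≤ infMeanEnergyOn (tiClassWith C R c₂) Ψ R)
    {lam : ℝ} (hl0 : 0 ≤ lam) (hl1 : lam ≤ 1)
    (hcap : infMeanEnergyOn (tiClassWith C R (fun k => lam * c₁ k + (1 - lam) * c₂ k)) Ψ R ≤ u) :
    infMeanEnergyOn (tiClassWith C R (fun k => lam * c₁ k + (1 - lam) * c₂ k)) Ψ R + (lam * f₁ + (1 - lam) * f₂ - u) ≤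
      ((InfVolFermionState.mix lam hl0 hl1 ω₁ ω₂).cellAverage q).meanEnergy Ψ R := by
  rw [cellAverage_mix]
  exact infMeanEnergyOn_tiClassWith_add_margin_le_meanEnergy_mix C Ψ R ⟨h₁.isTranslationInvariant_cellAverage, hc₁⟩
    ⟨h₂.isTranslationInvariant_cellAverage, hc₂⟩ hf₁ hf₂ hl0 hl1 hcap

/-! ### §3 Two phases with DIFFERENT period lattices: read the charges over the product cell -/

/-- **Certified exclusion for a `q₁`-periodic and a `q₂`-periodic phase** (both periodic under the product lattice
`Q_i + 1 = (q₁_i + 1)(q₂_i + 1)`): with the cell-average charges `c₁, c₂` read over the product cell, a certified cap/floors defect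
`u < a f₁ + b f₂` puts every phase-separated state strictly above `e` at its per-site charges. [cite: Israel1979, Thm. I.2.4] -/
theorem IsPeriodic.infMeanEnergyOn_tiClassWith_lt_meanEnergy_cellAverage_mix_of_cap_lt_floors₂ {q₁ q₂ : Fin d → ℕ}
    (h₁ : ω₁.IsPeriodic q₁) (h₂ : ω₂.IsPeriodic q₂) {c₁ c₂ : κ → ℝ}
    (hc₁ : ∀ k, (ω₁.cellAverage (fun j => (q₁ j + 1) * (q₂ j + 1) - 1)).meanEnergy (C k) R = c₁ k)
    (hc₂ : ∀ k, (ω₂.cellAverage (fun j => (q₁ j + 1) * (q₂ j + 1) - 1)).meanEnergy (C k) R = c₂ k)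
    {a b : ℝ} (ha : 0 ≤ a) (hb : 0 ≤ b) (hab : a + b = 1)
    {u f₁ f₂ : ℝ} (hcap : infMeanEnergyOn (tiClassWith C R (fun k => a * c₁ k + b * c₂ k)) Ψ R ≤ u)
    (hf₁ : f₁ ≤ infMeanEnergyOn (tiClassWith C R c₁) Ψ R) (hf₂ : f₂ ≤ infMeanEnergyOn (tiClassWith C R c₂) Ψ R)
    (hu : u < a * f₁ + b * f₂) {lam : ℝ} (hl0 : 0 < lam) (hl1 : lam < 1) :
    infMeanEnergyOn (tiClassWith C R (fun k => lam * c₁ k + (1 - lam) * c₂ k)) Ψ R <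
      ((InfVolFermionState.mix lam hl0.le hl1.le ω₁ ω₂).cellAverage (fun j => (q₁ j + 1) * (q₂ j + 1) - 1)).meanEnergy Ψ R :=
  IsPeriodic.infMeanEnergyOn_tiClassWith_lt_meanEnergy_cellAverage_mix_of_cap_lt_floors C Ψ R h₁.isPeriodic_prodPeriod_left
    h₂.isPeriodic_prodPeriod_right hc₁ hc₂ ha hb hab hcap hf₁ hf₂ hu hl0 hl1

end InfVolFermionState

end Literature.MathematicalPhysics.QuantumLattice

end
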